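import Literature.AlgebraicGeometry.Morphisms.CechH1Projective
import Literature.AlgebraicGeometry.HodgeTheory.ProjectiveHilbertToGrassmannianInjective
import HarnessLib

/-!
# A closed subscheme of `ℙ^r` with given Hilbert polynomial is cut out by the degree-`d` part of its homogeneous ideal

Topic `Literature/AlgebraicGeometry/Morphisms`, namespace `Literature.AlgebraicGeometry.Morphisms.ProjCech` (the chart language of ★
`Morphisms/CechH1Projective`).  THEOREMS ONLY (no definition, no instance, no notation, no named fact, no `sorry`).  Cell
`hodgecm-mathlib` (D-0151), F-DAG leaf F-5 (5d) (director s232; B-plan1 (g17) 09:09:40Z), FILE 3 of the (II′) MONO wrapper (author B-p20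
(g12), census `CENSUS-5dII-Mono` §0 (P)) — the POINTWISE theorem behind the fibre binder `hcut` of the relative head; consumers: the (II′)
assembly and B-p19 (g16)'s FILE γ.  Count-neutral Mathlib-side capital: HC_CM is proved only modulo the 7 printed citations until rung 0
closes — nothing here is about HC.

THE PRINT.  [Mumford1966CurvesSurface] Lecture 15 «The Hilbert scheme», step (V.) (pp. 107–108): for a closed subscheme `Z ⊂ ℙ^r_k` whose
ideal sheaf has Hilbert polynomial `Q` and `d ≥ m₀ = B(Q)` (Lecture 14's bound), «the image of `p^*(K)` in `o(m₀)` is exactly `o(-D + m₀)`.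
Therefore `𝓘` is `o(-D)`», i.e. **`Z` is the closed subscheme CUT OUT by the forms of degree `d` vanishing on it**: on every standard chart
`D₊(x_j)` the ideal of `Z` is generated by the dehomogenised forms `f / x_j^d`, `f ∈ 𝔞_d` ([Hartshorne1977] II Prop. 5.9, Cor. 5.16, Ex. 5.10).
In the tree's currency (`𝔞 = ProjCech.idealZ ι`, the homogeneous (saturated) ideal of `ι : Z ⟶ 𝐏^r_A`; `B_{{j}} = Γ(𝐏, D₊(x_j))` the
degree-zero localisation `LaurentCech.Bsub A r {j}`; `evalRing ι {j} : B_{{j}} → Γ(Z, Z_j)` the restriction, whose kernel is the ideal of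
`Z` on the chart — ★ `evalRing_eq_zero_of_mem_idealZ` / `exists_mem_idealZ_of_evalRing_eq_zero`; `fracB A j d f = f_d / x_j^d`):

* §1 (any ring `A`) `sat_KZ_le`/`sat_KZ_eq` — the homogeneous ideal of a closed subscheme is saturated; `fracB_mem_ker_evalRing`;
  **`ker_evalRing_eq_span_fracB_of_generated`** — if `𝔞_{≥ d}` is generated by `𝔞_d` then `ker (B_{{j}} → Γ(Z, Z_j))` is the ideal generated
  by the `f_d / x_j^d`, `f ∈ 𝔞`;
* §2 (`A = k` an infinite field, `r ≥ 1`) **`ker_evalRing_eq_span_fracB_of_hilbertPolynomial`** — the same for every closed `Z ⊂ ℙ^r_k` with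
  Hilbert polynomial `QZ` (letter of ★ `regular_quot_of_hilbertPolynomial_projectiveSpace` / B-p19 (g16)'s L-a seam) and every
  `d ≥ regularityBound C(z+r,r) 0 (C(z+r,r) - QZ)`, by Mumford's theorem ★ `mem_span_isHomog_of_forall_projDeg_eq_zero` /
  `regular_ideal_of_hilbertPolynomial` (Lecture 14: `𝔞̄_{≥B}` is generated by `𝔞̄_B`).

## References
* [Mumford1966CurvesSurface] D. Mumford, *Lectures on Curves on an Algebraic Surface* (1966), Lecture 14 (Theorem p. 101, p. 102),
  Lecture 15 (IV.)–(V.) (pp. 107–108).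
* [Hartshorne1977] R. Hartshorne, *Algebraic Geometry* (1977), II Prop. 5.9, Cor. 5.16 (p. 119), Ex. 5.10 (p. 125).
-/

noncomputable section

open CategoryTheory AlgebraicGeometry TopologicalSpace Opposite Polynomial
open Literature.Algebra.Homology Literature.Algebra.Homology.LaurentCech

universe u

attribute [local instance] MvPolynomial.gradedAlgebra
  Literature.AlgebraicGeometry.Motives.ProjBaseChange.algebraBase

namespace Literature.AlgebraicGeometry.Morphisms

namespace ProjCech

/-! ## §1 Any ring: saturation, and the chart ideal from generation in degree `d` -/

section AnyRing

variable {A : Type u} [CommRing A] {r : ℕ} {Z : Scheme.{u}} (ι : Z ⟶ PP A r)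

/-- **Shifting homogeneous components by a power of a variable**: `(x_j^n q)_{b+n} = x_j^n q_b`. [folklore] -/
private theorem hcomp_X_pow_mul (j : Fin (r + 1)) (n : ℕ) (b : ℤ) (q : P A r) :
    hcomp (b + n) (MvPolynomial.X j ^ n * q) = MvPolynomial.X j ^ n * hcomp b q := by
  apply toL_injective
  have hX : toL A r (MvPolynomial.X j ^ n) = xs A {j} (n : ℤ) := by rw [← Xs_singleton, toL_Xs_pow]
  rw [toL_hcomp, map_mul (toL A r), map_mul (toL A r), toL_hcomp, hX, mul_comm (xs A {j} (n : ℤ)),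
    mul_comm (xs A {j} (n : ℤ)), Lfilter_edeg_mul_of_mem _ (xs_mem_Ldeg (A := A) {j} (n : ℤ)), Finset.card_singleton,
    Nat.cast_one, mul_one, add_sub_cancel_right]

/-- `(x_j^n f)_{b+n} / x_j^{b+n} = f_b / x_j^b` in the degree-zero localisation `B_{{j}} = (P_{x_j})₀`. [cite: Hartshorne1977, II Prop. 2.5 (b) (p. 76)] -/
theorem fracB_X_pow_mul (j : Fin (r + 1)) (n : ℕ) (b : ℤ) (f : P A r) :
    fracB A j (b + n) (MvPolynomial.X j ^ n * f) = fracB A j b f := by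
  apply Subtype.ext
  have hX : toL A r (MvPolynomial.X j ^ n) = xs A {j} (n : ℤ) := by rw [← Xs_singleton, toL_Xs_pow]
  rw [coe_fracB, coe_fracB, fracL, fracL, hcomp_X_pow_mul, map_mul (toL A r), hX, neg_add, xs_add]
  calc xs A {j} (n : ℤ) * toL A r (hcomp b f) * (xs A {j} (-b) * xs A {j} (-(n : ℤ)))
      = toL A r (hcomp b f) * xs A {j} (-b) * (xs A {j} (n : ℤ) * xs A {j} (-(n : ℤ))) := by ring
    _ = toL A r (hcomp b f) * xs A {j} (-b) := by rw [xs_mul_xs_neg, mul_one]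

/-- `f_d / x_j^d ∈ ker (B_{{j}} → Γ(Z, Z_j))` for `f` in the homogeneous ideal of `Z` (the definition of `idealZ`).
[cite: Hartshorne1977, II Cor. 5.16 (a) (p. 119)] -/
theorem fracB_mem_ker_evalRing {f : P A r} (hf : f ∈ idealZ ι) (j : Fin (r + 1)) (b : ℤ) :
    fracB A j b f ∈ RingHom.ker (evalRing ι {j}) :=
  (mem_idealZ ι).1 hf b j

/-- **The homogeneous ideal of a closed subscheme is saturated**: if `x_i^n f ∈ 𝔞` for every `i` (some `n`), then `f ∈ 𝔞` — indeed
`f_b / x_j^b = (x_j^n f)_{b+n} / x_j^{b+n}` vanishes on `Z_j`. [cite: Hartshorne1977, II Ex. 5.10 (p. 125)] -/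
theorem sat_KZ_le : sat (KZ ι) ≤ KZ ι := by
  intro v hv
  rw [mem_KZ, mem_idealZ]
  intro b j
  obtain ⟨n, hn⟩ := (mem_sat (KZ ι)).1 hv j
  rw [mem_KZ, Pi.smul_apply, smul_eq_mul] at hn
  have h := (mem_idealZ ι).1 hn (b + n) j
  rwa [fracB_X_pow_mul] at h

/-- `sat 𝔞 = 𝔞` for the homogeneous ideal of a closed subscheme. [cite: Hartshorne1977, II Ex. 5.10 (p. 125)] -/
theorem sat_KZ_eq : sat (KZ ι) = KZ ι :=
  le_antisymm (sat_KZ_le ι) (le_sat _)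

/-- A degree-zero fraction `x ∈ B_{{j}} = (P_{x_j})₀` with `x_j^N x = f` a polynomial IS `f_N / x_j^N`. [cite: Hartshorne1977, II Prop. 2.5 (b) (p. 76)] -/
theorem eq_fracB_of_xs_mul_eq (j : Fin (r + 1)) {x : Bsub A r {j}} {N : ℕ} {f : P A r}
    (hx : xs A {j} N * (x : L A r) = toL A r f) : x = fracB A j N f := by
  have hfdeg : toL A r f ∈ Ldeg A r (N : ℤ) := by
    rw [← hx]
    have := mul_mem_Ldeg (xs_mem_Ldeg (A := A) {j} (N : ℤ)) x.2.1
    rwa [Finset.card_singleton, Nat.cast_one, mul_one, add_zero] at this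
  apply Subtype.ext
  rw [coe_fracB, fracL, hcomp_eq_self_of_toL_mem hfdeg, ← hx]
  calc (x : L A r) = (xs A {j} (N : ℤ) * xs A {j} (-(N : ℤ))) * x := by rw [xs_mul_xs_neg, one_mul]
    _ = xs A {j} (N : ℤ) * (x : L A r) * xs A {j} (-(N : ℤ)) := by ring

/-- All fractions `g_M / x_j^M` of an element `g` of the `P`-span of the degree-`d` forms of `𝔞` lie in the ideal of `B_{{j}}` generated by
the `f_d / x_j^d`, `f ∈ 𝔞` (`fracB` of a product is a sum of products, ★ `fracB_mul`, and of a degree-`d` form is its `x_j^d`-fraction or `0`,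
★ `fracB_hcomp`). [cite: Hartshorne1977, II Cor. 5.16 (a) (p. 119)] -/
theorem fracB_mem_span_of_mem_span (j : Fin (r + 1)) (d : ℤ) {v : Unit → P A r}
    (hv : v ∈ Submodule.span (P A r) {w : Unit → P A r | w ∈ KZ ι ∧ IsHomog (fun _ : Unit => (0 : ℤ)) d w}) (M : ℤ) :
    fracB A j M (v ()) ∈ Ideal.span (Set.range fun f : idealZ ι => fracB A j d (f : P A r)) := by
  induction hv using Submodule.span_induction generalizing M with
  | mem w hw =>
    obtain ⟨hwK, hwhom⟩ := hw
    have hwd : hcomp d (w ()) = w () := by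
      have h := congrFun hwhom ()
      rwa [projDeg_apply, sub_zero] at h
    rw [← hwd, fracB_hcomp]
    split_ifs with hM
    · exact Ideal.subset_span ⟨⟨w (), (mem_KZ ι).1 hwK⟩, rfl⟩
    · exact Ideal.zero_mem _
  | zero => rw [Pi.zero_apply, fracB_zero]; exact Ideal.zero_mem _
  | add v w _ _ hv hw => rw [Pi.add_apply, fracB_add]; exact Ideal.add_mem _ (hv M) (hw M)
  | smul p v _ hv =>
    rw [Pi.smul_apply, smul_eq_mul, fracB_mul]
    exact Ideal.sum_mem _ fun c _ => Ideal.mul_mem_left _ _ (hv c)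

/-- **If `𝔞_{≥ d}` is generated by `𝔞_d`, the ideal of `Z` on the chart `D₊(x_j)` is generated by the dehomogenised degree-`d` forms**:
`ker (B_{{j}} → Γ(Z, Z_j)) = ⟨f_d / x_j^d : f ∈ 𝔞⟩` (`ι` affine, e.g. a closed immersion).  `⊇` is the definition of `𝔞`; for `⊆`, a
fraction in the kernel is `f / x_j^N` with `f ∈ 𝔞_N` (★ `exists_mem_idealZ_of_evalRing_eq_zero`); if `N < d` it is `(x_j^{d-N} f) / x_j^d`,
and if `N ≥ d` then `f` is a `P`-combination of degree-`d` forms of `𝔞`. [cite: Mumford1966CurvesSurface, Lecture 15 (V.) (pp. 107–108)]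
[cite: Hartshorne1977, II Prop. 5.9, Cor. 5.16 (p. 119)] -/
theorem ker_evalRing_eq_span_fracB_of_generated [IsAffineHom ι] (d : ℕ)
    (hgen : ∀ v ∈ KZ ι, (∀ d' : ℤ, d' < d → projDeg (fun _ : Unit => (0 : ℤ)) d' v = 0) →
      v ∈ Submodule.span (P A r) {w : Unit → P A r | w ∈ KZ ι ∧ IsHomog (fun _ : Unit => (0 : ℤ)) d w})
    (j : Fin (r + 1)) :
    RingHom.ker (evalRing ι {j}) = Ideal.span (Set.range fun f : idealZ ι => fracB A j d (f : P A r)) := by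
  apply le_antisymm
  · intro x hx
    obtain ⟨N, f, hf, hxf⟩ := exists_mem_idealZ_of_evalRing_eq_zero ι ((RingHom.mem_ker).1 hx)
    rw [eq_fracB_of_xs_mul_eq j hxf]
    rcases lt_or_ge N d with hNd | hNd
    · -- `f / x_j^N = (x_j^{d-N} f) / x_j^d`
      obtain ⟨m, rfl⟩ := Nat.exists_eq_add_of_lt hNd
      have hrew : fracB A j ((N + m + 1 : ℕ) : ℤ) (MvPolynomial.X j ^ (m + 1) * f) = fracB A j N f := by
        rw [show ((N + m + 1 : ℕ) : ℤ) = (N : ℤ) + ((m + 1 : ℕ) : ℤ) by push_cast; ring]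
        exact fracB_X_pow_mul j (m + 1) N f
      rw [← hrew]
      exact Ideal.subset_span ⟨⟨_, Ideal.mul_mem_left _ _ hf⟩, rfl⟩
    · -- `N ≥ d`: `f ∈ 𝔞_N` is a combination of degree-`d` forms of `𝔞`
      have hfdeg : toL A r f ∈ Ldeg A r (N : ℤ) := by
        rw [← hxf]
        have := mul_mem_Ldeg (xs_mem_Ldeg (A := A) {j} (N : ℤ)) x.2.1
        rwa [Finset.card_singleton, Nat.cast_one, mul_one, add_zero] at this
      have hfN : hcomp N f = f := hcomp_eq_self_of_toL_mem hfdeg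
      have hv : (fun _ : Unit => f) ∈ KZ ι := (mem_KZ ι).2 hf
      have hvB : ∀ d' : ℤ, d' < d → projDeg (fun _ : Unit => (0 : ℤ)) d' (fun _ : Unit => f) = 0 := by
        intro d' hd'
        funext u
        rw [projDeg_apply, sub_zero, Pi.zero_apply, ← hfN, hcomp_hcomp, if_neg (by omega)]
      exact fracB_mem_span_of_mem_span ι j d (hgen _ hv hvB) N
  · rw [Ideal.span_le]
    rintro _ ⟨f, rfl⟩
    exact fracB_mem_ker_evalRing ι f.2 j d

end AnyRing

/-! ## §2 Over an infinite field: generation in degree `d ≥ B(QZ)` from the Hilbert polynomial (Mumford, Lecture 14) -/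

section Field

variable {k : Type u} [Field k] [Infinite k] {r : ℕ} {Z : Scheme.{u}} (ι : Z ⟶ PP k r)

omit [Infinite k] in
/-- The Euler characteristics of the ideal sheaf from those of `𝒪_Z`: `χ(Č_n(𝔞)) = C(n+r, r) - QZ(n)` (additivity of `χ` on
`0 → 𝔞 → P → P⧸𝔞 → 0`, ★ `eulerChar_quot_eq_add_of_le`, ★ `eulerChar_quot_bot_eq_eval_preHilbertPoly`).
[cite: Hartshorne1977, III Ex. 5.1 (p. 230)] -/
theorem eulerChar_cech_KZ_eq_of_hilbertPolynomial (hr : 1 ≤ r) {QZ : Polynomial ℚ}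
    (hQZ : ∀ n : ℤ, ((∑ q ∈ Finset.range (r + 1), (-1 : ℤ) ^ q *
      (Module.finrank k ((quot (fun _ : Unit => (0 : ℤ)) (KZ ι) n).homology q) : ℤ) : ℤ) : ℚ) = QZ.eval (n : ℚ))
    (n : ℤ) :
    ((∑ q ∈ Finset.range (r + 1), (-1 : ℤ) ^ q *
      (Module.finrank k ((cech (fun _ : Unit => (0 : ℤ)) (KZ ι) n).homology q) : ℤ) : ℤ) : ℚ) =
        (preHilbertPoly ℚ r 0 - QZ).eval (n : ℚ) := by
  rw [← eulerCharSubquot_bot_eq, Polynomial.eval_sub, ← hQZ n, ← eulerChar_quot_bot_eq_eval_preHilbertPoly (k := k) hr n,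
    eulerCharSubquot_def, eulerChar_quot_eq_add_of_le (fun _ : Unit => (0 : ℤ)) (isGraded_bot _) (isGraded_KZ ι) bot_le n]
  push_cast
  ring

/-- **`𝔞_{≥d}` is generated by `𝔞_d` for `d ≥ B(QZ)`** (Mumford's theorem ★ `regular_ideal_of_hilbertPolynomial` (a) read through ★
`mem_span_isHomog_of_forall_projDeg_eq_zero`, with `sat 𝔞 = 𝔞` by §1). [cite: Mumford1966CurvesSurface, Lecture 14 (Theorem p. 101, p. 102)] -/
theorem mem_span_isHomog_KZ_of_hilbertPolynomial (hr : 1 ≤ r) {QZ : Polynomial ℚ}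
    (hQZ : ∀ n : ℤ, ((∑ q ∈ Finset.range (r + 1), (-1 : ℤ) ^ q *
      (Module.finrank k ((quot (fun _ : Unit => (0 : ℤ)) (KZ ι) n).homology q) : ℤ) : ℤ) : ℚ) = QZ.eval (n : ℚ))
    {d : ℕ} (hd : regularityBound (preHilbertPoly ℚ r 0) 0 (preHilbertPoly ℚ r 0 - QZ) ≤ (d : ℤ))
    {v : Unit → P k r} (hv : v ∈ KZ ι) (hvB : ∀ d' : ℤ, d' < d → projDeg (fun _ : Unit => (0 : ℤ)) d' v = 0) :
    v ∈ Submodule.span (P k r) {w : Unit → P k r | w ∈ KZ ι ∧ IsHomog (fun _ : Unit => (0 : ℤ)) d w} := by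
  have hreg := regular_ideal_of_hilbertPolynomial hr (KZ ι) (isGraded_KZ ι) (eulerChar_cech_KZ_eq_of_hilbertPolynomial ι hr hQZ)
  have h := mem_span_isHomog_of_forall_projDeg_eq_zero (fun _ : Unit => (0 : ℤ)) hr (isGraded_KZ ι) (d : ℤ)
    (fun n hn => hreg.2 n (hd.trans hn)) ((le_sat _) hv) hvB
  rwa [sat_KZ_eq] at h

/-- **A closed subscheme of `ℙ^r_k` is cut out, on each standard chart, by the dehomogenised forms of degree `d` vanishing on it** whenever
`d ≥ B(QZ) = regularityBound C(z+r,r) 0 (C(z+r,r) - QZ)`, `QZ` its Hilbert polynomial (`k` infinite, `r ≥ 1`; ★ letter `hQZ` of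
`regular_quot_of_hilbertPolynomial_projectiveSpace`): `ker (B_{{j}} → Γ(Z, Z_j)) = ⟨f_d / x_j^d : f ∈ 𝔞⟩` — the pointwise content of
[Mumford1966CurvesSurface] Lecture 15 (V.) «`𝓘` is the image of `p^*(K)(-m₀)`». [cite: Mumford1966CurvesSurface, Lecture 15 (IV.)–(V.) (pp. 107–108)]
[cite: Hartshorne1977, II Prop. 5.9, Cor. 5.16 (p. 119)] -/
theorem ker_evalRing_eq_span_fracB_of_hilbertPolynomial (hr : 1 ≤ r) [IsClosedImmersion ι] {QZ : Polynomial ℚ}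
    (hQZ : ∀ n : ℤ, ((∑ q ∈ Finset.range (r + 1), (-1 : ℤ) ^ q *
      (Module.finrank k ((quot (fun _ : Unit => (0 : ℤ)) (KZ ι) n).homology q) : ℤ) : ℤ) : ℚ) = QZ.eval (n : ℚ))
    {d : ℕ} (hd : regularityBound (preHilbertPoly ℚ r 0) 0 (preHilbertPoly ℚ r 0 - QZ) ≤ (d : ℤ)) (j : Fin (r + 1)) :
    RingHom.ker (evalRing ι {j}) = Ideal.span (Set.range fun f : idealZ ι => fracB k j d (f : P k r)) :=
  ker_evalRing_eq_span_fracB_of_generated ι d (fun _ hv hvB => mem_span_isHomog_KZ_of_hilbertPolynomial ι hr hQZ hd hv hvB) j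

end Field

end ProjCech

end Literature.AlgebraicGeometry.Morphisms

end
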